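import Mathlib
import Summits.NavierStokesRegularity.NavierStokesRegularity.Theorems.FilamentSkeletonRssKelvinGatePressureGradient

/-!
# Route `FilamentSkeletonRss` · cruxes `TransverseReductionRJ` (stmt-21221, aside) / `TransverseReduction1A` (stmt-27414) —
# line `kelvin_gate`: the dipole potential of a `⟨y⟩^{-k}` density, `2 ≤ k < 3` — SUBCRITICAL DECAY `⟨x⟩^{-(k−1)}`

Helper file (theorems only, `--as helper`).  HONEST FRAMING: analysis bookkeeping for a HYPOTHETICAL filament-type rotating
self-similar blow-up route; nothing here bears on Navier–Stokes regularity; no stub is proved here.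

Real-exponent version of `…KelvinGatePressureDecay` (which is `k = 2`): piece (m1) of the sharp-weights design
(evidence SHARP-WEIGHTS-DESIGN-21221-g7 on 27414/21221).  With `V = 3|B₁|` and
`C_k = 2^{k−1} + 4·2^{3−k}/(3−k) + 4·2^{1−k}/(k−1)`:

* `lintegral_norm_sub_rpow_neg_two_mul_weight_rpow_neg_le` — **`∫ |x − y|⁻² (1+|y|)^{-k} dy ≤ C_k V (1+|x|)^{1−k}`** for `2 ≤ k < 3`;
* `integral_norm_sub_rpow_neg_two_mul_weight_rpow_neg_le` — integrability and the real-valued form;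
* `norm_newtonGradPotential_le_of_weight_rpow` — **`‖T_a g(x)‖ ≤ (‖a‖R/4π) C_k V (1+|x|)^{1−k}`** for a Banach-valued density with
  `(1+|y|)^k ‖g‖ ≤ R`: for `k > 2` the free pressure gradient of a `Y♯`-datum decays SUBCRITICALLY (`k − 1 > 1`), which is what removes the
  Calderón–Zygmund step from the free Kelvin gate.
-/

set_option linter.dupNamespace false

noncomputable section

namespace Summit.NavierStokesRegularity.NavierStokesRegularity.Theorems.KelvinGate

open Set Function Filter MeasureTheory Metric Real
open Literature.Analysis.FluidPDE Literature.Analysis.FluidPDE.NewtonPotentialHolder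
open scoped ENNReal Topology

/-! ## Pointwise bounds on the three regions (real exponent) -/

/-- Near region: `(1+|y|)^{-k} ≤ ((1+|x|)/2)^{-k}` on `B(x,(1+|x|)/2)`, `k ≥ 0`. -/
theorem weight_rpow_neg_le_of_mem_ball {k : ℝ} (hk : 0 ≤ k) {x y : EuclideanSpace ℝ (Fin 3)}
    (hy : y ∈ ball x ((1 + ‖x‖) / 2)) :
    (1 + ‖y‖) ^ (-k) ≤ ((1 + ‖x‖) / 2) ^ (-k) := by
  rw [mem_ball, dist_eq_norm] at hy
  have h1 : ‖x‖ - ‖y‖ ≤ ‖y - x‖ := by rw [norm_sub_rev]; exact norm_sub_norm_le x y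
  have h2 : (1 + ‖x‖) / 2 ≤ 1 + ‖y‖ := by linarith
  have h3 : 0 < (1 + ‖x‖) / 2 := by linarith [norm_nonneg x]
  exact rpow_le_rpow_of_nonpos h3 h2 (by linarith)

/-- `(1+|y|)^{-k} ≤ |y|^{-k}` for `y ≠ 0`, `k ≥ 0`. -/
theorem weight_rpow_neg_le_norm_rpow_neg {k : ℝ} (hk : 0 ≤ k) {y : EuclideanSpace ℝ (Fin 3)} (hy : y ≠ 0) :
    (1 + ‖y‖) ^ (-k) ≤ ‖y‖ ^ (-k) :=
  rpow_le_rpow_of_nonpos (norm_pos_iff.2 hy) (by linarith) (by linarith)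

/-- Exterior region: for `|y| ≥ 2(1+|x|)`, `|x − y|⁻² (1+|y|)^{-k} ≤ 4 |y|^{-(2+k)}` (`k ≥ 0`). -/
theorem norm_sub_rpow_neg_two_mul_weight_rpow_neg_le_of_not_mem_ball {k : ℝ} (hk : 0 ≤ k) {x y : EuclideanSpace ℝ (Fin 3)}
    (hy : y ∉ ball (0 : EuclideanSpace ℝ (Fin 3)) (2 * (1 + ‖x‖))) :
    ‖x - y‖ ^ (-(2:ℝ)) * (1 + ‖y‖) ^ (-k) ≤ 4 * ‖y‖ ^ (-(2 + k)) := by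
  rw [mem_ball_zero_iff, not_lt] at hy
  have hy0 : 0 < ‖y‖ := by linarith [norm_nonneg x]
  have hyne : y ≠ 0 := norm_pos_iff.1 hy0
  have h1 : ‖y‖ - ‖x‖ ≤ ‖x - y‖ := by rw [norm_sub_rev]; exact norm_sub_norm_le y x
  have h2 : ‖y‖ / 2 ≤ ‖x - y‖ := by linarith [norm_nonneg x]
  have hA : ‖x - y‖ ^ (-(2:ℝ)) ≤ 4 * ‖y‖ ^ (-(2:ℝ)) := by
    calc ‖x - y‖ ^ (-(2:ℝ)) ≤ (‖y‖ / 2) ^ (-(2:ℝ)) := rpow_le_rpow_of_nonpos (by positivity) h2 (by norm_num)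
      _ = 4 * ‖y‖ ^ (-(2:ℝ)) := by
          rw [div_rpow hy0.le zero_le_two, rpow_neg zero_le_two, rpow_two]; norm_num; ring
  have hB : (1 + ‖y‖) ^ (-k) ≤ ‖y‖ ^ (-k) := weight_rpow_neg_le_norm_rpow_neg hk hyne
  calc ‖x - y‖ ^ (-(2:ℝ)) * (1 + ‖y‖) ^ (-k) ≤ (4 * ‖y‖ ^ (-(2:ℝ))) * ‖y‖ ^ (-k) :=
        mul_le_mul hA hB (rpow_nonneg (by positivity) _) (by positivity)
    _ = 4 * ‖y‖ ^ (-(2 + k)) := by rw [mul_assoc, ← rpow_add hy0]; congr 2; ring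

/-! ## The weighted dipole integral, real exponent -/

/-- **`∫ |x − y|⁻² (1+|y|)^{-k} dy ≤ C_k V (1+|x|)^{1−k}`** for `2 ≤ k < 3`, `V = 3|B₁|`,
`C_k = 2^{k−1} + 4·2^{3−k}/(3−k) + 4·2^{1−k}/(k−1)` (in `ℝ≥0∞`). -/
theorem lintegral_norm_sub_rpow_neg_two_mul_weight_rpow_neg_le {k : ℝ} (hk2 : 2 ≤ k) (hk3 : k < 3)
    (x : EuclideanSpace ℝ (Fin 3)) :
    ∫⁻ y, ENNReal.ofReal (‖x - y‖ ^ (-(2:ℝ)) * (1 + ‖y‖) ^ (-k)) ≤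
      ENNReal.ofReal (((2:ℝ) ^ (k - 1) + 4 * (2:ℝ) ^ (3 - k) / (3 - k) + 4 * (2:ℝ) ^ (1 - k) / (k - 1)) *
        (3 * (volume : Measure (EuclideanSpace ℝ (Fin 3))).real (ball 0 1)) * (1 + ‖x‖) ^ (1 - k)) := by
  have hk0 : 0 ≤ k := by linarith
  set ρ : ℝ := 1 + ‖x‖ with hρ
  have hρ1 : 1 ≤ ρ := by rw [hρ]; linarith [norm_nonneg x]
  have hρ0 : 0 < ρ := by linarith
  set V : ℝ := 3 * (volume : Measure (EuclideanSpace ℝ (Fin 3))).real (ball 0 1) with hV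
  have hV0 : 0 ≤ V := three_mul_volume_real_ball_nonneg
  set f : EuclideanSpace ℝ (Fin 3) → ℝ≥0∞ := fun y => ENNReal.ofReal (‖x - y‖ ^ (-(2:ℝ)) * (1 + ‖y‖) ^ (-k)) with hf
  set S : Set (EuclideanSpace ℝ (Fin 3)) := ball x (ρ / 2) with hS
  set T : Set (EuclideanSpace ℝ (Fin 3)) := ball (0 : EuclideanSpace ℝ (Fin 3)) (2 * ρ) with hT
  have hSm : MeasurableSet S := measurableSet_ball
  have hTm : MeasurableSet T := measurableSet_ball
  have hc1 : 0 ≤ (ρ / 2) ^ (-k) := rpow_nonneg (by positivity) _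
  -- (1) the near ball
  have h1 : ∫⁻ y in S, f y ≤ ENNReal.ofReal ((2:ℝ) ^ (k - 1) * V * ρ ^ (1 - k)) := by
    calc ∫⁻ y in S, f y ≤ ∫⁻ y in S, ENNReal.ofReal ((ρ / 2) ^ (-k)) * ENNReal.ofReal (‖x - y‖ ^ (-(2:ℝ))) := by
          refine setLIntegral_mono' hSm fun y hy => ?_
          rw [← ENNReal.ofReal_mul hc1, mul_comm ((ρ / 2) ^ (-k))]
          exact ENNReal.ofReal_le_ofReal
            (mul_le_mul_of_nonneg_left (weight_rpow_neg_le_of_mem_ball hk0 hy) (rpow_nonneg (norm_nonneg _) _))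
      _ = ENNReal.ofReal ((ρ / 2) ^ (-k)) * ∫⁻ y in S, ENNReal.ofReal (‖x - y‖ ^ (-(2:ℝ))) :=
          lintegral_const_mul' _ _ ENNReal.ofReal_ne_top
      _ = ENNReal.ofReal ((ρ / 2) ^ (-k)) * ENNReal.ofReal (V * ((ρ / 2) ^ (3 - (2:ℝ)) / (3 - (2:ℝ)))) := by
          rw [hS, lintegral_ball_comp_sub_left (fun z => ENNReal.ofReal (‖z‖ ^ (-(2:ℝ)))) x (ρ / 2),
            lintegral_ball_norm_rpow_neg (by norm_num) (by positivity)]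
      _ = ENNReal.ofReal ((2:ℝ) ^ (k - 1) * V * ρ ^ (1 - k)) := by
          rw [← ENNReal.ofReal_mul hc1]
          congr 1
          rw [show (3:ℝ) - 2 = 1 by norm_num, rpow_one, div_one, div_rpow hρ0.le zero_le_two, rpow_neg zero_le_two,
            show ρ ^ (1 - k) = ρ * ρ ^ (-k) by rw [sub_eq_add_neg, rpow_add hρ0, rpow_one],
            show (2:ℝ) ^ (k - 1) = (2:ℝ) ^ k / 2 by rw [rpow_sub two_pos, rpow_one]]
          field_simp
  -- (2) the annulus `Sᶜ ∩ T`
  have hae : ∀ᵐ y ∂(volume : Measure (EuclideanSpace ℝ (Fin 3))), y ≠ 0 := ae_ne_zero_volume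
  have hT2 : ∫⁻ y in T, ENNReal.ofReal ((1 + ‖y‖) ^ (-k)) ≤ ENNReal.ofReal (V * ((2 * ρ) ^ (3 - k) / (3 - k))) := by
    calc ∫⁻ y in T, ENNReal.ofReal ((1 + ‖y‖) ^ (-k)) ≤ ∫⁻ y in T, ENNReal.ofReal (‖y‖ ^ (-k)) := by
          refine lintegral_mono_ae (ae_restrict_of_ae ?_)
          filter_upwards [hae] with y hy
          exact ENNReal.ofReal_le_ofReal (weight_rpow_neg_le_norm_rpow_neg hk0 hy)
      _ = ENNReal.ofReal (V * ((2 * ρ) ^ (3 - k) / (3 - k))) := by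
          rw [hT, lintegral_ball_norm_rpow_neg hk3 (by positivity)]
  have h2 : ∫⁻ y in Sᶜ ∩ T, f y ≤ ENNReal.ofReal (4 * (2:ℝ) ^ (3 - k) / (3 - k) * V * ρ ^ (1 - k)) := by
    calc ∫⁻ y in Sᶜ ∩ T, f y ≤ ∫⁻ y in Sᶜ ∩ T, ENNReal.ofReal (4 / ρ ^ 2) * ENNReal.ofReal ((1 + ‖y‖) ^ (-k)) := by
          refine setLIntegral_mono' (hSm.compl.inter hTm) fun y hy => ?_
          rw [← ENNReal.ofReal_mul (by positivity)]
          exact ENNReal.ofReal_le_ofReal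
            (mul_le_mul_of_nonneg_right (norm_sub_rpow_neg_two_le_of_not_mem_ball hy.1) (rpow_nonneg (by positivity) _))
      _ = ENNReal.ofReal (4 / ρ ^ 2) * ∫⁻ y in Sᶜ ∩ T, ENNReal.ofReal ((1 + ‖y‖) ^ (-k)) :=
          lintegral_const_mul' _ _ ENNReal.ofReal_ne_top
      _ ≤ ENNReal.ofReal (4 / ρ ^ 2) * ∫⁻ y in T, ENNReal.ofReal ((1 + ‖y‖) ^ (-k)) :=
          mul_le_mul' le_rfl (lintegral_mono_set inter_subset_right)
      _ ≤ ENNReal.ofReal (4 / ρ ^ 2) * ENNReal.ofReal (V * ((2 * ρ) ^ (3 - k) / (3 - k))) := mul_le_mul' le_rfl hT2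
      _ = ENNReal.ofReal (4 * (2:ℝ) ^ (3 - k) / (3 - k) * V * ρ ^ (1 - k)) := by
          rw [← ENNReal.ofReal_mul (by positivity)]
          congr 1
          have h3k : (3:ℝ) - k ≠ 0 := by linarith
          rw [mul_rpow zero_le_two hρ0.le,
            show ρ ^ (3 - k) = ρ ^ 2 * ρ ^ (1 - k) by
              rw [show (3:ℝ) - k = 2 + (1 - k) by ring, rpow_add hρ0, rpow_two]]
          field_simp
  -- (3) the exterior `Sᶜ \ T`
  have h3 : ∫⁻ y in Sᶜ \ T, f y ≤ ENNReal.ofReal (4 * (2:ℝ) ^ (1 - k) / (k - 1) * V * ρ ^ (1 - k)) := by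
    calc ∫⁻ y in Sᶜ \ T, f y ≤ ∫⁻ y in Sᶜ \ T, ENNReal.ofReal 4 * ENNReal.ofReal (‖y‖ ^ (-(2 + k))) := by
          refine setLIntegral_mono' (hSm.compl.diff hTm) fun y hy => ?_
          rw [← ENNReal.ofReal_mul (by norm_num)]
          exact ENNReal.ofReal_le_ofReal (norm_sub_rpow_neg_two_mul_weight_rpow_neg_le_of_not_mem_ball hk0 hy.2)
      _ = ENNReal.ofReal 4 * ∫⁻ y in Sᶜ \ T, ENNReal.ofReal (‖y‖ ^ (-(2 + k))) :=
          lintegral_const_mul' _ _ ENNReal.ofReal_ne_top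
      _ ≤ ENNReal.ofReal 4 * ∫⁻ y in Tᶜ, ENNReal.ofReal (‖y‖ ^ (-(2 + k))) :=
          mul_le_mul' le_rfl (lintegral_mono_set fun y hy => hy.2)
      _ = ENNReal.ofReal 4 * ENNReal.ofReal (V * ((2 * ρ) ^ (3 - (2 + k)) / ((2 + k) - 3))) := by
          rw [hT, lintegral_compl_ball_norm_rpow_neg (by linarith) (by positivity)]
      _ = ENNReal.ofReal (4 * (2:ℝ) ^ (1 - k) / (k - 1) * V * ρ ^ (1 - k)) := by
          rw [← ENNReal.ofReal_mul (by norm_num)]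
          congr 1
          have hk1 : k - 1 ≠ 0 := by linarith
          rw [show (3:ℝ) - (2 + k) = 1 - k by ring, show (2:ℝ) + k - 3 = k - 1 by ring, mul_rpow zero_le_two hρ0.le]
          field_simp
  -- assemble
  calc ∫⁻ y, f y = (∫⁻ y in S, f y) + ∫⁻ y in Sᶜ, f y := (lintegral_add_compl f hSm).symm
    _ = (∫⁻ y in S, f y) + ((∫⁻ y in Sᶜ ∩ T, f y) + ∫⁻ y in Sᶜ \ T, f y) := by
        rw [lintegral_inter_add_sdiff f Sᶜ hTm]
    _ ≤ ENNReal.ofReal ((2:ℝ) ^ (k - 1) * V * ρ ^ (1 - k)) +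
          (ENNReal.ofReal (4 * (2:ℝ) ^ (3 - k) / (3 - k) * V * ρ ^ (1 - k)) +
            ENNReal.ofReal (4 * (2:ℝ) ^ (1 - k) / (k - 1) * V * ρ ^ (1 - k))) :=
        add_le_add h1 (add_le_add h2 h3)
    _ = ENNReal.ofReal (((2:ℝ) ^ (k - 1) + 4 * (2:ℝ) ^ (3 - k) / (3 - k) + 4 * (2:ℝ) ^ (1 - k) / (k - 1)) * V *
          ρ ^ (1 - k)) := by
        have hA : 0 ≤ (2:ℝ) ^ (k - 1) * V * ρ ^ (1 - k) := by positivity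
        have hB : 0 ≤ 4 * (2:ℝ) ^ (3 - k) / (3 - k) * V * ρ ^ (1 - k) := by
          have : 0 < 3 - k := by linarith
          positivity
        have hC : 0 ≤ 4 * (2:ℝ) ^ (1 - k) / (k - 1) * V * ρ ^ (1 - k) := by
          have : 0 < k - 1 := by linarith
          positivity
        rw [← ENNReal.ofReal_add hB hC, ← ENNReal.ofReal_add hA (add_nonneg hB hC)]
        congr 1
        ring

/-- Real-valued form: integrability of the weighted dipole integrand and `∫ |x − y|⁻² (1+|y|)^{-k} dy ≤ C_k V (1+|x|)^{1−k}`. -/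
theorem integral_norm_sub_rpow_neg_two_mul_weight_rpow_neg_le {k : ℝ} (hk2 : 2 ≤ k) (hk3 : k < 3)
    (x : EuclideanSpace ℝ (Fin 3)) :
    Integrable (fun y => ‖x - y‖ ^ (-(2:ℝ)) * (1 + ‖y‖) ^ (-k)) (volume : Measure (EuclideanSpace ℝ (Fin 3))) ∧
    ∫ y, ‖x - y‖ ^ (-(2:ℝ)) * (1 + ‖y‖) ^ (-k) ≤
      ((2:ℝ) ^ (k - 1) + 4 * (2:ℝ) ^ (3 - k) / (3 - k) + 4 * (2:ℝ) ^ (1 - k) / (k - 1)) *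
        (3 * (volume : Measure (EuclideanSpace ℝ (Fin 3))).real (ball 0 1)) * (1 + ‖x‖) ^ (1 - k) := by
  have hV0 : 0 ≤ 3 * (volume : Measure (EuclideanSpace ℝ (Fin 3))).real (ball 0 1) := three_mul_volume_real_ball_nonneg
  have hρ0 : 0 < 1 + ‖x‖ := by linarith [norm_nonneg x]
  have hCk : 0 ≤ (2:ℝ) ^ (k - 1) + 4 * (2:ℝ) ^ (3 - k) / (3 - k) + 4 * (2:ℝ) ^ (1 - k) / (k - 1) := by
    have : 0 < 3 - k := by linarith
    have : 0 < k - 1 := by linarith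
    positivity
  have hnn : ∀ y, 0 ≤ ‖x - y‖ ^ (-(2:ℝ)) * (1 + ‖y‖) ^ (-k) := fun y =>
    mul_nonneg (rpow_nonneg (norm_nonneg _) _) (rpow_nonneg (by positivity) _)
  have hmeas : AEStronglyMeasurable (fun y => ‖x - y‖ ^ (-(2:ℝ)) * (1 + ‖y‖) ^ (-k))
      (volume : Measure (EuclideanSpace ℝ (Fin 3))) := by
    refine (Measurable.mul ?_ ?_).aestronglyMeasurable
    · exact ((continuous_const.sub continuous_id).norm.measurable).pow_const _
    · exact (continuous_const.add continuous_norm).measurable.pow_const _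
  have hlt := lintegral_norm_sub_rpow_neg_two_mul_weight_rpow_neg_le hk2 hk3 x
  have hfin : HasFiniteIntegral (fun y => ‖x - y‖ ^ (-(2:ℝ)) * (1 + ‖y‖) ^ (-k))
      (volume : Measure (EuclideanSpace ℝ (Fin 3))) := by
    refine lt_of_le_of_lt ?_ (hlt.trans_lt ENNReal.ofReal_lt_top)
    refine lintegral_mono fun y => ?_
    rw [Real.enorm_eq_ofReal (hnn y)]
  refine ⟨⟨hmeas, hfin⟩, ?_⟩
  rw [integral_eq_lintegral_of_nonneg_ae (Eventually.of_forall hnn) hmeas]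
  exact ENNReal.toReal_le_of_le_ofReal (by positivity) hlt

/-! ## The dipole potential of a `⟨y⟩^{-k}` density -/

section Banach

variable {G : Type*} [NormedAddCommGroup G] [NormedSpace ℝ G]

/-- Pointwise bound off the pole: `‖∂ₐΓ(x − y) • g(y)‖ ≤ (‖a‖R/4π) |x − y|⁻² (1+|y|)^{-k}` when `(1+|y|)^k ‖g(y)‖ ≤ R`, `y ≠ x`. -/
theorem norm_fderiv_newtonKernel_smul_le_of_weight_rpow {k : ℝ} {g : EuclideanSpace ℝ (Fin 3) → G} {R : ℝ}
    (hg : ∀ y, (1 + ‖y‖) ^ k * ‖g y‖ ≤ R) (a : EuclideanSpace ℝ (Fin 3)) {x y : EuclideanSpace ℝ (Fin 3)} (hxy : y ≠ x) :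
    ‖fderiv ℝ newtonKernel (x - y) a • g y‖ ≤ ‖a‖ * R / (4 * π) * (‖x - y‖ ^ (-(2:ℝ)) * (1 + ‖y‖) ^ (-k)) := by
  have hne : x - y ≠ 0 := sub_ne_zero.2 (Ne.symm hxy)
  have hpos : 0 < ‖x - y‖ := norm_pos_iff.2 hne
  have hw : 0 < (1 + ‖y‖) ^ k := rpow_pos_of_pos (by linarith [norm_nonneg y]) _
  have hgy : ‖g y‖ ≤ R * (1 + ‖y‖) ^ (-k) := by
    rw [rpow_neg (by positivity), ← div_eq_mul_inv, le_div_iff₀ hw, mul_comm]; exact hg y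
  have hK : ‖fderiv ℝ newtonKernel (x - y) a‖ ≤ (4 * π * ‖x - y‖ ^ 2)⁻¹ * ‖a‖ := by
    rw [← norm_fderiv_newtonKernel hne]; exact ContinuousLinearMap.le_opNorm _ _
  rw [norm_smul, rpow_neg hpos.le, rpow_two]
  calc ‖fderiv ℝ newtonKernel (x - y) a‖ * ‖g y‖
      ≤ (4 * π * ‖x - y‖ ^ 2)⁻¹ * ‖a‖ * (R * (1 + ‖y‖) ^ (-k)) :=
        mul_le_mul hK hgy (norm_nonneg _) (by positivity)
    _ = ‖a‖ * R / (4 * π) * ((‖x - y‖ ^ 2)⁻¹ * (1 + ‖y‖) ^ (-k)) := by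
        field_simp

/-- **`‖T_a g(x)‖ ≤ (‖a‖R/4π) C_k V (1+|x|)^{1−k}`** for a density with `(1+|y|)^k ‖g(y)‖ ≤ R`, `2 ≤ k < 3`: SUBCRITICAL decay of the free
pressure gradient of a `Y♯`-datum when `k > 2`. -/
theorem norm_newtonGradPotential_le_of_weight_rpow {k : ℝ} (hk2 : 2 ≤ k) (hk3 : k < 3)
    {g : EuclideanSpace ℝ (Fin 3) → G} {R : ℝ} (hg : ∀ y, (1 + ‖y‖) ^ k * ‖g y‖ ≤ R) (a x : EuclideanSpace ℝ (Fin 3)) :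
    ‖newtonGradPotential a g x‖ ≤
      ‖a‖ * R / (4 * π) * (((2:ℝ) ^ (k - 1) + 4 * (2:ℝ) ^ (3 - k) / (3 - k) + 4 * (2:ℝ) ^ (1 - k) / (k - 1)) *
        (3 * (volume : Measure (EuclideanSpace ℝ (Fin 3))).real (ball 0 1)) * (1 + ‖x‖) ^ (1 - k)) := by
  have hR : 0 ≤ R := le_trans (by positivity) (hg 0)
  obtain ⟨hb, hI⟩ := integral_norm_sub_rpow_neg_two_mul_weight_rpow_neg_le hk2 hk3 x
  have h0 : (volume : Measure (EuclideanSpace ℝ (Fin 3))) {x} = 0 := measure_singleton x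
  have hbound : ∀ᵐ y ∂(volume : Measure (EuclideanSpace ℝ (Fin 3))),
      ‖fderiv ℝ newtonKernel (x - y) a • g y‖ ≤ ‖a‖ * R / (4 * π) * (‖x - y‖ ^ (-(2:ℝ)) * (1 + ‖y‖) ^ (-k)) := by
    filter_upwards [compl_mem_ae_iff.2 h0] with y hy
    have hyx : y ≠ x := by simpa using hy
    exact norm_fderiv_newtonKernel_smul_le_of_weight_rpow hg a hyx
  unfold newtonGradPotential
  calc ‖∫ y, fderiv ℝ newtonKernel (x - y) a • g y‖
      ≤ ∫ y, ‖a‖ * R / (4 * π) * (‖x - y‖ ^ (-(2:ℝ)) * (1 + ‖y‖) ^ (-k)) :=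
        norm_integral_le_of_norm_le (hb.const_mul _) hbound
    _ = ‖a‖ * R / (4 * π) * ∫ y, ‖x - y‖ ^ (-(2:ℝ)) * (1 + ‖y‖) ^ (-k) := integral_const_mul _ _
    _ ≤ _ := mul_le_mul_of_nonneg_left hI (by positivity)

end Banach

end Summit.NavierStokesRegularity.NavierStokesRegularity.Theorems.KelvinGate

end
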